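import Literature.RingTheory.MvPolynomial.HomogeneousHilbertFunction
import Literature.RingTheory.KrullDimension.AffineCatenary
import Mathlib.RingTheory.KrullDimension.NonZeroDivisors
import Mathlib.RingTheory.KrullDimension.Polynomial
import Mathlib.RingTheory.KrullDimension.Field
import Mathlib.RingTheory.Ideal.KrullsHeightTheorem
import Mathlib.RingTheory.Ideal.MinimalPrime.Localization
import Mathlib.RingTheory.Ideal.MinimalPrime.Noetherian
import Mathlib.RingTheory.GradedAlgebra.Radical
import Mathlib.RingTheory.MvPolynomial.Ideal
import HarnessLib

/-!
# Dimension of homogeneous ideals of `K[X₀, …, X_{m-1}]`: hyperplane sections and Artinian pieces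

Topic: `Literature/RingTheory/MvPolynomial`. Krull-dimension lemmas for the degree theory of
homogeneous ideals (the dimension of `I` is read as `dim S ⧸ I`, Mathlib `ringKrullDim`;
for a homogeneous ideal this is one more than the dimension of its projective zero set):

* `isHomogeneous_of_mem_minimalPrimes` — minimal primes of a homogeneous ideal are homogeneous
  (via Mathlib `Ideal.IsPrime.homogeneousCore`);
* `le_ker_constantCoeff_of_isHomogeneous` — a proper homogeneous ideal lies in the irrelevant
  ideal `𝔪 = (X_0, …, X_{m-1}) = ker constantCoeff`; `exists_X_notMem_of_ringKrullDim_ne_zero` —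
  a prime `𝔭` with `dim S/𝔭 ≠ 0` misses some variable;
* `exists_X_pow_mem_of_ringKrullDim_le_zero`, `idealDegree_eq_of_X_pow_mem` — if `dim S/I ≤ 0`
  for a proper homogeneous `I` then every variable has a power in `I`, and then `I_t = S_t`
  (`H(I; t) = 0`) for all large `t`;
* **`ringKrullDim_quotient_sup_span_lt`** — cutting by an element outside the top-dimensional
  minimal primes lowers `dim S ⧸ I` (any commutative ring, `dim S/I` finite);
* `exists_linearForm_forall_notMem` — over an infinite field, finitely many primes each missing
  a variable are simultaneously avoided by a linear form (`HomogeneousHilbertFunction.lean`);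
* **`ringKrullDim_quotient_add_one_of_mem_minimalPrimes_sup_span`** — for a prime `𝔭` of
  `S = K[X]` and `Q ∉ 𝔭`, every minimal prime `P` of `𝔭 + (Q)` has `dim S/P + 1 = dim S/𝔭`
  (Krull's principal ideal theorem, Mathlib `Ideal.map_height_le_one_of_mem_minimalPrimes`, and
  the catenary dimension formula for affine domains,
  `Literature.RingTheory.KrullDimension.ringKrullDim_quotient_add_height`).

These are the dimension-theoretic inputs of Hartshorne I.7.5 / I.7.7 and of the Bézout-type
counting of Nesterenko–Philippon (eds.), LNM 1752, Ch. 11 §2.2 and Prop. 2.2.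

## References

* R. Hartshorne, *Algebraic Geometry*, GTM 52 (1977), Ch. I §7. [Hartshorne1977]
* H. Matsumura, *Commutative Ring Theory* (1986), Thm 5.6, Thm 13.5. [Matsumura1987]
-/

noncomputable section

open MvPolynomial Module

attribute [local instance] MvPolynomial.gradedAlgebra

namespace Literature.RingTheory.MvPolynomial

variable {K : Type*} [Field K] {σ : Type*}

/-! ## Homogeneous primes and the irrelevant ideal -/

/-- **Minimal primes of a homogeneous ideal are homogeneous** (the homogeneous core of a prime
is prime). [folklore] -/
theorem isHomogeneous_of_mem_minimalPrimes {I 𝔭 : Ideal (MvPolynomial σ K)}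
    (hI : I.IsHomogeneous (homogeneousSubmodule σ K)) (h𝔭 : 𝔭 ∈ I.minimalPrimes) :
    𝔭.IsHomogeneous (homogeneousSubmodule σ K) := by
  have hprime : 𝔭.IsPrime := h𝔭.1.1
  have hcore : (𝔭.homogeneousCore (homogeneousSubmodule σ K)).toIdeal = 𝔭 := by
    refine le_antisymm (Ideal.toIdeal_homogeneousCore_le _ _) ?_
    refine h𝔭.2 ⟨hprime.homogeneousCore, ?_⟩ (Ideal.toIdeal_homogeneousCore_le _ _)
    rw [← hI.toIdeal_homogeneousCore_eq_self]
    exact Ideal.homogeneousCore_mono _ h𝔭.1.2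
  rw [← hcore]
  exact (𝔭.homogeneousCore (homogeneousSubmodule σ K)).isHomogeneous

/-- The variables lie in the irrelevant ideal `ker constantCoeff`. [folklore] -/
theorem X_mem_ker_constantCoeff (i : σ) :
    (X i : MvPolynomial σ K) ∈ RingHom.ker (constantCoeff : MvPolynomial σ K →+* K) := by
  rw [RingHom.mem_ker, constantCoeff_X]

/-- The irrelevant ideal `ker constantCoeff = (X_i : i)` is maximal. [folklore] -/
theorem isMaximal_ker_constantCoeff :
    (RingHom.ker (constantCoeff : MvPolynomial σ K →+* K)).IsMaximal :=
  RingHom.ker_isMaximal_of_surjective _ fun a => ⟨C a, constantCoeff_C _ a⟩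

/-- The irrelevant ideal is generated by the variables: it is contained in every ideal containing
all the variables. [folklore] -/
theorem ker_constantCoeff_le_of_forall_X_mem {𝔭 : Ideal (MvPolynomial σ K)}
    (h : ∀ i, (X i : MvPolynomial σ K) ∈ 𝔭) :
    RingHom.ker (constantCoeff : MvPolynomial σ K →+* K) ≤ 𝔭 := by
  intro f hf
  have hspan : f ∈ Ideal.span (MvPolynomial.X '' (Set.univ : Set σ) : Set (MvPolynomial σ K)) := by
    rw [mem_ideal_span_X_image]
    intro m hm
    by_contra hcon
    push Not at hcon
    have hm0 : m = 0 := by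
      ext i
      simpa using hcon i (Set.mem_univ i)
    subst hm0
    exact (mem_support_iff.mp hm) hf
  refine (Ideal.span_le.mpr ?_) hspan
  rintro _ ⟨i, -, rfl⟩
  exact h i

/-- **A proper homogeneous ideal lies in the irrelevant ideal**: the degree-`0` component of a
member is a constant in the ideal, hence `0`. [folklore] -/
theorem le_ker_constantCoeff_of_isHomogeneous {I : Ideal (MvPolynomial σ K)}
    (hI : I.IsHomogeneous (homogeneousSubmodule σ K)) (hI' : I ≠ ⊤) :
    I ≤ RingHom.ker (constantCoeff : MvPolynomial σ K →+* K) := by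
  intro f hf
  rw [RingHom.mem_ker]
  by_contra hc
  apply hI'
  have h0 : homogeneousComponent 0 f ∈ I := homogeneousComponent_mem_of_mem hI hf 0
  rw [homogeneousComponent_zero] at h0
  exact Ideal.eq_top_of_isUnit_mem I h0 ((isUnit_iff_ne_zero.mpr hc).map C)

/-- A prime containing all the variables is the irrelevant ideal, so its quotient is a field and
has Krull dimension `0`; hence **a prime `𝔭` with `dim S/𝔭 ≠ 0` misses some variable**.
[folklore] -/
theorem exists_X_notMem_of_ringKrullDim_ne_zero {𝔭 : Ideal (MvPolynomial σ K)} [𝔭.IsPrime]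
    (h : ringKrullDim (MvPolynomial σ K ⧸ 𝔭) ≠ 0) : ∃ i, (X i : MvPolynomial σ K) ∉ 𝔭 := by
  by_contra hcon
  push Not at hcon
  have hle := ker_constantCoeff_le_of_forall_X_mem (K := K) hcon
  have heq : RingHom.ker (constantCoeff : MvPolynomial σ K →+* K) = 𝔭 :=
    (isMaximal_ker_constantCoeff.eq_of_le (Ideal.IsPrime.ne_top inferInstance) hle)
  have hmax : 𝔭.IsMaximal := heq ▸ isMaximal_ker_constantCoeff
  exact h (ringKrullDim_eq_zero_of_isField
    ((Ideal.Quotient.maximal_ideal_iff_isField_quotient 𝔭).mp hmax))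

/-! ## Krull dimension bookkeeping -/

/-- Two comparable primes `𝔭 < 𝔮` give `dim R/𝔭 ≥ 1`. [folklore] -/
theorem one_le_ringKrullDim_quotient_of_lt {R : Type*} [CommRing R] {𝔭 𝔮 : Ideal R}
    [𝔭.IsPrime] [𝔮.IsPrime] (h : 𝔭 < 𝔮) : 1 ≤ ringKrullDim (R ⧸ 𝔭) := by
  rw [ringKrullDim_quotient, Order.one_le_krullDim_iff]
  refine ⟨⟨⟨𝔭, inferInstance⟩, fun x hx => hx⟩, ⟨⟨𝔮, inferInstance⟩, fun x hx => h.le hx⟩, ?_⟩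
  change (⟨𝔭, inferInstance⟩ : PrimeSpectrum R) < ⟨𝔮, inferInstance⟩
  exact h

/-- `dim S = m` for `S = K[X_0, …, X_{m-1}]`. [folklore] -/
theorem ringKrullDim_mvPolynomial_fin (m : ℕ) :
    ringKrullDim (MvPolynomial (Fin m) K) = (m : WithBot ℕ∞) := by
  rw [MvPolynomial.ringKrullDim_of_isNoetherianRing, ringKrullDim_eq_zero_of_field, zero_add,
    Nat.card_eq_fintype_card, Fintype.card_fin]

/-- The dimension of a proper quotient of `K[X_0, …, X_{m-1}]` is a natural number `≤ m`.
[folklore] -/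
theorem exists_nat_ringKrullDim_quotient_eq {m : ℕ} {I : Ideal (MvPolynomial (Fin m) K)}
    (hI : I ≠ ⊤) : ∃ n : ℕ, ringKrullDim (MvPolynomial (Fin m) K ⧸ I) = n ∧ n ≤ m := by
  have hnt : Nontrivial (MvPolynomial (Fin m) K ⧸ I) := Ideal.Quotient.nontrivial_iff.mpr hI
  have h0 : 0 ≤ ringKrullDim (MvPolynomial (Fin m) K ⧸ I) := ringKrullDim_nonneg_of_nontrivial
  have hm : ringKrullDim (MvPolynomial (Fin m) K ⧸ I) ≤ m :=
    (ringKrullDim_quotient_le I).trans (ringKrullDim_mvPolynomial_fin (K := K) m).le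
  generalize hv : ringKrullDim (MvPolynomial (Fin m) K ⧸ I) = v at h0 hm
  induction v using WithBot.recBotCoe with
  | bot => exact absurd h0 (by simp)
  | coe v =>
    induction v using ENat.recTopCoe with
    | top =>
      exfalso
      have : ((m : ℕ∞) : WithBot ℕ∞) < ((⊤ : ℕ∞) : WithBot ℕ∞) := WithBot.coe_lt_coe.mpr (ENat.coe_lt_top m)
      exact absurd hm (not_le.mpr this)
    | coe n =>
      refine ⟨n, rfl, ?_⟩
      have : ((n : ℕ∞) : WithBot ℕ∞) ≤ ((m : ℕ∞) : WithBot ℕ∞) := hm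
      exact_mod_cast this

/-- **Cutting by an element outside the top-dimensional minimal primes lowers the dimension**
(any commutative ring): if `dim R/I ≤ n` and `dim R/𝔭 < n` for every minimal prime `𝔭` of `I`
containing `x`, then `dim R/(I + (x)) < n`: a chain of primes above `I + (x)` starts above a
minimal prime `𝔭` of `I`; either `x ∈ 𝔭` and the chain is bounded by `dim R/𝔭`, or `x ∉ 𝔭` and
the chain extends strictly below by `𝔭`. [folklore] -/
theorem ringKrullDim_quotient_sup_span_lt {R : Type*} [CommRing R] {I : Ideal R} {x : R} {n : ℕ}
    (hI : ringKrullDim (R ⧸ I) ≤ n)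
    (hx : ∀ 𝔭 ∈ I.minimalPrimes, x ∈ 𝔭 → ringKrullDim (R ⧸ 𝔭) < n) :
    ringKrullDim (R ⧸ (I ⊔ Ideal.span {x})) < n := by
  rw [ringKrullDim_quotient, Order.krullDim_lt_coe_iff]
  intro l
  have hJ : I ⊔ Ideal.span {x} ≤ (l.head).1.asIdeal := l.head.2
  obtain ⟨𝔭, h𝔭, h𝔭le⟩ := Ideal.exists_minimalPrimes_le (le_sup_left.trans hJ)
  have h𝔭prime : 𝔭.IsPrime := h𝔭.1.1
  by_cases hx𝔭 : x ∈ 𝔭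
  · -- the chain lies above `𝔭`
    have hlt := hx 𝔭 h𝔭 hx𝔭
    rw [ringKrullDim_quotient, Order.krullDim_lt_coe_iff] at hlt
    let l' : LTSeries (PrimeSpectrum.zeroLocus (R := R) (𝔭 : Set R)) :=
      ⟨l.length, fun i => ⟨(l i).1, fun y hy => (l.head_le i) (h𝔭le hy)⟩, fun i => l.step i⟩
    exact hlt l'
  · -- `𝔭 < l.head`: prepend `𝔭`
    have hlt : (⟨⟨𝔭, h𝔭prime⟩, fun y hy => h𝔭.1.2 hy⟩ : PrimeSpectrum.zeroLocus (R := R) (I : Set R)) <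
        ⟨(l.head).1, fun y hy => hJ (Ideal.mem_sup_left hy)⟩ := by
      change (⟨𝔭, h𝔭prime⟩ : PrimeSpectrum R) < (l.head).1
      refine lt_of_le_of_ne h𝔭le fun heq => hx𝔭 ?_
      have : x ∈ (l.head).1.asIdeal := hJ (Ideal.mem_sup_right (Ideal.mem_span_singleton_self x))
      rwa [← heq] at this
    let l' : LTSeries (PrimeSpectrum.zeroLocus (R := R) (I : Set R)) :=
      (l.map (fun q => ⟨q.1, fun y hy => q.2 (Ideal.mem_sup_left hy)⟩) fun _ _ h => h).cons
        ⟨⟨𝔭, h𝔭prime⟩, fun y hy => h𝔭.1.2 hy⟩ (by simpa [RelSeries.head_map] using hlt)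
    have hlen : (l'.length : WithBot ℕ∞) ≤ ringKrullDim (R ⧸ I) := by
      rw [ringKrullDim_quotient]
      exact Order.LTSeries.length_le_krullDim l'
    have hlen' : l'.length = l.length + 1 := by simp [l']
    rw [hlen'] at hlen
    have := hlen.trans hI
    have : ((l.length + 1 : ℕ) : WithBot ℕ∞) ≤ (n : WithBot ℕ∞) := by exact_mod_cast this
    have : l.length + 1 ≤ n := by exact_mod_cast this
    omega

/-- **The dimension of `R/I` is attained at a minimal prime**: if `dim R/I = n` is finite there is
a minimal prime `𝔭` of `I` with `dim R/𝔭 = n` (a longest chain of primes above `I` starts above a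
minimal prime). [folklore] -/
theorem exists_minimalPrimes_ringKrullDim_quotient_eq {R : Type*} [CommRing R] {I : Ideal R}
    {n : ℕ} (hI : ringKrullDim (R ⧸ I) = n) :
    ∃ 𝔭 ∈ I.minimalPrimes, ringKrullDim (R ⧸ 𝔭) = n := by
  have hle : (n : WithBot ℕ∞) ≤ Order.krullDim (PrimeSpectrum.zeroLocus (R := R) (I : Set R)) := by
    rw [← ringKrullDim_quotient, hI]
  obtain ⟨l, hl⟩ := Order.le_krullDim_iff.mp hle
  have hJ : I ≤ (l.head).1.asIdeal := l.head.2
  obtain ⟨𝔭, h𝔭, h𝔭le⟩ := Ideal.exists_minimalPrimes_le hJ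
  refine ⟨𝔭, h𝔭, le_antisymm ?_ ?_⟩
  · rw [← hI]
    exact ringKrullDim_le_of_surjective (Ideal.Quotient.factor h𝔭.1.2)
      (Ideal.Quotient.factor_surjective h𝔭.1.2)
  · let l' : LTSeries (PrimeSpectrum.zeroLocus (R := R) (𝔭 : Set R)) :=
      ⟨l.length, fun i => ⟨(l i).1, fun y hy => (l.head_le i) (h𝔭le hy)⟩, fun i => l.step i⟩
    have := Order.LTSeries.length_le_krullDim l'
    rw [← ringKrullDim_quotient] at this
    rw [← hl]
    exact this

/-! ## Artinian homogeneous ideals: `H(I; t) = 0` for large `t` -/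

/-- **If `dim S/I ≤ 0` for a homogeneous ideal `I`, every variable has a power in `I`**: every
minimal prime of `I` is a homogeneous prime of dimension `0`, hence the irrelevant ideal, so
`X_i ∈ √I`. [folklore] -/
theorem exists_X_pow_mem_of_ringKrullDim_le_zero {I : Ideal (MvPolynomial σ K)}
    (hI : I.IsHomogeneous (homogeneousSubmodule σ K))
    (hdim : ringKrullDim (MvPolynomial σ K ⧸ I) ≤ 0) (i : σ) :
    ∃ n : ℕ, (X i : MvPolynomial σ K) ^ n ∈ I := by
  suffices hrad : (X i : MvPolynomial σ K) ∈ I.radical from hrad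
  rw [← Ideal.sInf_minimalPrimes, Ideal.mem_sInf]
  intro 𝔭 h𝔭
  have hprime : 𝔭.IsPrime := h𝔭.1.1
  -- `𝔭` is homogeneous and proper, so inside the irrelevant ideal `𝔪`
  have hle : 𝔭 ≤ RingHom.ker (constantCoeff : MvPolynomial σ K →+* K) :=
    le_ker_constantCoeff_of_isHomogeneous (isHomogeneous_of_mem_minimalPrimes hI h𝔭) hprime.ne_top
  -- and `dim S/𝔭 ≤ dim S/I ≤ 0` forces `𝔭 = 𝔪`
  rcases hle.lt_or_eq with hlt | heq
  · exfalso
    haveI := isMaximal_ker_constantCoeff (K := K) (σ := σ) |>.isPrime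
    have h1 : 1 ≤ ringKrullDim (MvPolynomial σ K ⧸ 𝔭) := one_le_ringKrullDim_quotient_of_lt hlt
    have h2 : ringKrullDim (MvPolynomial σ K ⧸ 𝔭) ≤ ringKrullDim (MvPolynomial σ K ⧸ I) :=
      ringKrullDim_le_of_surjective (Ideal.Quotient.factor h𝔭.1.2)
        (Ideal.Quotient.factor_surjective h𝔭.1.2)
    have := (h1.trans h2).trans hdim
    exact absurd this (by decide)
  · rw [heq]
    exact X_mem_ker_constantCoeff i

/-- A monomial one of whose exponents is large lies in an ideal containing the corresponding power
of the variable. [folklore] -/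
theorem monomial_mem_of_X_pow_mem {I : Ideal (MvPolynomial σ K)} {i : σ} {n : ℕ}
    (h : (X i : MvPolynomial σ K) ^ n ∈ I) {a : σ →₀ ℕ} (ha : n ≤ a i) (c : K) :
    monomial a c ∈ I := by
  classical
  have hadd : Finsupp.single i n + (a - Finsupp.single i n) = a := by
    ext j
    rw [Finsupp.add_apply, Finsupp.tsub_apply, Finsupp.single_apply]
    split_ifs with hij
    · subst hij; omega
    · omega
  have hsplit : monomial a c = X i ^ n * monomial (a - Finsupp.single i n) c := by
    rw [X_pow_eq_monomial, monomial_mul, one_mul, hadd]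
  rw [hsplit]
  exact I.mul_mem_right _ h

/-- **If every variable has a power in `I` then `I_t = S_t` for all large `t`** (`m` variables,
powers `≤ N`: every monomial of degree `≥ m·N` has an exponent `≥ N`). Hence `H(I; t) = 0` for
`t ≫ 0`. [folklore] -/
theorem idealDegree_eq_of_X_pow_mem {m : ℕ} {I : Ideal (MvPolynomial (Fin m) K)}
    (h : ∀ i, ∃ n : ℕ, (X i : MvPolynomial (Fin m) K) ^ n ∈ I) :
    ∃ t₀ : ℕ, ∀ t, t₀ ≤ t → 1 ≤ t →
      idealDegree I t = homogeneousSubmodule (Fin m) K t := by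
  classical
  choose n hn using h
  refine ⟨m * (Finset.univ.sup n), fun t ht ht1 => ?_⟩
  refine le_antisymm inf_le_right fun f hf => ⟨?_, hf⟩
  -- every monomial of `f` has degree `t`, hence an exponent `≥ sup n ≥ n i`
  rw [f.as_sum]
  refine I.sum_mem fun a ha => ?_
  have hdeg : a.degree = t := by
    have := (mem_homogeneousSubmodule t f).mp hf
    rw [Finsupp.degree_eq_weight_one]
    exact this (mem_support_iff.mp ha)
  -- some coordinate of `a` is at least `sup n`
  have hex : ∃ i, Finset.univ.sup n ≤ a i := by
    by_contra hcon
    push Not at hcon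
    have hm : 0 < m := by
      rcases Nat.eq_zero_or_pos m with hm0 | hm0
      · subst hm0
        exfalso
        have : a = 0 := by ext i; exact i.elim0
        rw [this, map_zero] at hdeg
        omega
      · exact hm0
    haveI : Nonempty (Fin m) := ⟨⟨0, hm⟩⟩
    have hsum : a.degree < m * Finset.univ.sup n := by
      rw [Finsupp.degree_eq_sum]
      calc ∑ i, a i < ∑ _i : Fin m, Finset.univ.sup n :=
            Finset.sum_lt_sum_of_nonempty Finset.univ_nonempty fun i _ => hcon i
        _ = m * Finset.univ.sup n := by
            rw [Finset.sum_const, smul_eq_mul, Finset.card_univ, Fintype.card_fin]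
    omega
  obtain ⟨i, hi⟩ := hex
  exact monomial_mem_of_X_pow_mem (hn i) ((Finset.le_sup (Finset.mem_univ i)).trans hi) _

/-- Hilbert-function form: under the same hypothesis `H(I; t) = 0` for all large `t`.
[folklore] -/
theorem hilbert_eq_zero_of_X_pow_mem {m : ℕ} {I : Ideal (MvPolynomial (Fin m) K)}
    (h : ∀ i, ∃ n : ℕ, (X i : MvPolynomial (Fin m) K) ^ n ∈ I) :
    ∃ t₀ : ℕ, ∀ t, t₀ ≤ t →
      finrank K (homogeneousSubmodule (Fin m) K t) - finrank K (idealDegree I t) = 0 := by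
  obtain ⟨t₀, ht₀⟩ := idealDegree_eq_of_X_pow_mem h
  refine ⟨max t₀ 1, fun t ht => ?_⟩
  rw [ht₀ t (le_of_max_le_left ht) (le_of_max_le_right ht), Nat.sub_self]

/-! ## General linear forms -/

/-- **Avoiding finitely many primes by a linear form** (`K` infinite): if each prime of a finite
family misses some variable, some linear form `ℓ ∈ S_1`, `ℓ ≠ 0`, lies in none of them.
[folklore] -/
theorem exists_linearForm_forall_notMem [Infinite K] {m : ℕ} (hm : 0 < m)
    (P : Finset (Ideal (MvPolynomial (Fin m) K)))
    (hP : ∀ 𝔭 ∈ P, ∃ i, (X i : MvPolynomial (Fin m) K) ∉ 𝔭) :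
    ∃ ℓ : MvPolynomial (Fin m) K, ℓ.IsHomogeneous 1 ∧ ℓ ≠ 0 ∧ ∀ 𝔭 ∈ P, ℓ ∉ 𝔭 := by
  classical
  have h := exists_mem_forall_notMem_of_forall_not_le (K := K)
    (homogeneousSubmodule (Fin m) K 1)
    (insert ⊥ (P.image fun 𝔭 : Ideal (MvPolynomial (Fin m) K) => 𝔭.restrictScalars K)) ?_
  · obtain ⟨ℓ, hℓ1, hℓ⟩ := h
    refine ⟨ℓ, hℓ1, ?_, fun 𝔭 h𝔭 => hℓ (𝔭.restrictScalars K)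
      (Finset.mem_insert_of_mem (Finset.mem_image_of_mem _ h𝔭))⟩
    intro h0
    exact hℓ ⊥ (Finset.mem_insert_self _ _) (by rw [h0]; exact Submodule.zero_mem _)
  · intro W hW hle
    rcases Finset.mem_insert.mp hW with rfl | hW
    · have hX : (X ⟨0, hm⟩ : MvPolynomial (Fin m) K) ∈ (⊥ : Submodule K (MvPolynomial (Fin m) K)) :=
        hle (isHomogeneous_X K _)
      exact X_ne_zero _ ((Submodule.mem_bot K).mp hX)
    · obtain ⟨𝔭, h𝔭, rfl⟩ := Finset.mem_image.mp hW
      obtain ⟨i, hi⟩ := hP 𝔭 h𝔭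
      exact hi (hle (isHomogeneous_X K i))


/-! ## Minimal primes over a hypersurface section of a prime -/

/-- **Cutting a prime by a hypersurface lowers the dimension by exactly one** (Krull's principal
ideal theorem with the catenary property of affine domains; Hartshorne I.7.1 / Matsumura Thm 13.5
with Thm 5.6): for a prime `𝔭` of `S = K[X_0, …, X_{m-1}]`, `Q ∉ 𝔭`, and a minimal prime `P` of
`𝔭 + (Q)`, `dim S/P + 1 = dim S/𝔭`. [cite: Matsumura1987, Thm 13.5] -/
theorem ringKrullDim_quotient_add_one_of_mem_minimalPrimes_sup_span {m : ℕ}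
    {𝔭 P : Ideal (MvPolynomial (Fin m) K)} [𝔭.IsPrime] {Q : MvPolynomial (Fin m) K}
    (hQ : Q ∉ 𝔭) (hP : P ∈ (𝔭 ⊔ Ideal.span {Q}).minimalPrimes) :
    ringKrullDim (MvPolynomial (Fin m) K ⧸ P) + 1 = ringKrullDim (MvPolynomial (Fin m) K ⧸ 𝔭) := by
  set A := MvPolynomial (Fin m) K ⧸ 𝔭 with hA
  haveI : Algebra.FiniteType K A :=
    Algebra.FiniteType.of_surjective (Ideal.Quotient.mkₐ K 𝔭) (Ideal.Quotient.mkₐ_surjective K 𝔭)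
  have h𝔭P : 𝔭 ≤ P := le_sup_left.trans hP.1.2
  haveI hPprime : P.IsPrime := hP.1.1
  set Pbar : Ideal A := P.map (Ideal.Quotient.mk 𝔭) with hPbar
  haveI : Pbar.IsPrime := Ideal.isPrime_map_quotientMk_of_isPrime h𝔭P
  -- height of `P̄` is exactly one
  have hle : Pbar.height ≤ 1 := Ideal.map_height_le_one_of_mem_minimalPrimes hP
  have hne : Pbar ≠ ⊥ := by
    intro h0
    have hQP : Ideal.Quotient.mk 𝔭 Q ∈ Pbar :=
      Ideal.mem_map_of_mem _ (hP.1.2 (Ideal.mem_sup_right (Ideal.mem_span_singleton_self Q)))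
    rw [h0, Ideal.mem_bot, Ideal.Quotient.eq_zero_iff_mem] at hQP
    exact hQ hQP
  have hheight : Pbar.height = 1 := by
    refine le_antisymm hle ?_
    rw [Order.one_le_iff_ne_zero, Ne, Ideal.height_eq_zero_iff_eq_bot]
    exact hne
  have hcat := Literature.RingTheory.KrullDimension.ringKrullDim_quotient_add_height (F := K) Pbar
  rw [hheight] at hcat
  have e : A ⧸ Pbar ≃+* MvPolynomial (Fin m) K ⧸ P := DoubleQuot.quotQuotEquivQuotOfLE h𝔭P
  rw [ringKrullDim_eq_of_ringEquiv e] at hcat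
  exact_mod_cast hcat

end Literature.RingTheory.MvPolynomial

end
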